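import Mathlib
import Literature.AlgebraicGeometry.Resolution.AlterationsNormalFormStrictTransform
import Literature.AlgebraicGeometry.Resolution.ProjectiveSpaceRegular
import HarnessLib

/-!
# Regularity of a vanishing-ideal centre read from one affine chart

(crux stmt-ResolutionOfSingularities-15640 `WildQuotients.WildQuotientResolution`, line `Sketch`;
tower infrastructure (4a) of `L/w45c/CHAIN.md` v4 §4 row stub-2 / `W45cPlanSignaturesV4.lean` §C,
registered stub `isRegular_subscheme_vanishingIdeal_of_subset` BY NAME AND SIGNATURE;
[OURS · L1 W4.5c] — NOT a statement of any manuscript.)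

If a closed subset `Z` of a locally Noetherian scheme `V` lies inside ONE affine open `W` and the
ring `Γ(W)/𝓘_Z(W)` is regular, then the reduced closed subscheme `𝓘_Z.subscheme` of `V` on `Z` is a
regular scheme. Proof: `Spec (Γ(W)/𝓘_Z(W)) → Spec Γ(W) = W ⊆ V` is a preimmersion with image
`V(𝓘_Z(W)) ∩ W = Z ∩ W = Z` (Mathlib `IsAffineOpen.fromSpec_image_zeroLocus`,
`IdealSheafData.coe_support_inter`), closed, hence a closed immersion from a regular scheme
(`Scheme.isRegular_Spec`), and a closed immersion from a regular scheme identifies it with the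
reduced closed subscheme on its image (`isRegular_subscheme_vanishingIdeal_range`). This is the
input of `IsBlowup.isRegular_of_isRegular_subscheme` at each step of a one-chart tower
(R1A-TOWER-MEMO item (4)); companion (4b) is the tree's
`Literature.AlgebraicGeometry.Resolution.vanishingIdeal_comap_eq_of_preimage_eq`.
-/

-- single-problem summit: the doubled namespace component `ResolutionOfSingularities` is forced
set_option linter.dupNamespace false

noncomputable section

open CategoryTheory AlgebraicGeometry TopologicalSpace Literature.AlgebraicGeometry.Resolution

namespace Summit.ResolutionOfSingularities.ResolutionOfSingularities.Theorems.WildQuotientResolution.TowerCentre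

/-- **(4a) regularity of a vanishing-ideal centre from one affine chart**: if the closed set `Z`
lies inside an affine open `W` and `Γ(W)/𝓘_Z(W)` is a regular ring, the reduced closed subscheme
`𝓘_Z.subscheme` is regular (it is the image of the closed immersion
`Spec (Γ(W)/𝓘_Z(W)) → W ⊆ V`, whose range is `V(𝓘_Z(W)) ∩ W = Z`). [OURS · L1 W4.5c] [folklore] -/
theorem isRegular_subscheme_vanishingIdeal_of_subset {V : Scheme.{0}} [IsLocallyNoetherian V]
    (Z : TopologicalSpace.Closeds V) (W : V.Opens) (hW : IsAffineOpen W) (hZW : (Z : Set V) ⊆ W)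
    (hreg : IsRegularRing
      (Γ(V, W) ⧸ (Scheme.IdealSheafData.vanishingIdeal Z).ideal ⟨W, hW⟩)) :
    Scheme.IsRegular (Scheme.IdealSheafData.vanishingIdeal Z).subscheme := by
  set I := Scheme.IdealSheafData.vanishingIdeal Z with hI
  set J : Ideal Γ(V, W) := I.ideal ⟨W, hW⟩ with hJ
  -- the closed immersion `Spec (Γ(W)/J) → W ⊆ V`
  let j : Spec (CommRingCat.of (Γ(V, W) ⧸ J)) ⟶ V :=
    Spec.map (CommRingCat.ofHom (Ideal.Quotient.mk J)) ≫ hW.fromSpec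
  have hrange : Set.range j = (Z : Set V) := by
    have h1 : Set.range (Spec.map (CommRingCat.ofHom (Ideal.Quotient.mk J))) =
        PrimeSpectrum.zeroLocus (J : Set Γ(V, W)) := by
      change Set.range (PrimeSpectrum.comap (Ideal.Quotient.mk J)) = _
      rw [range_comap_of_surjective _ _ Ideal.Quotient.mk_surjective, Ideal.mk_ker]
    have hj : Set.range j =
        hW.fromSpec '' Set.range (Spec.map (CommRingCat.ofHom (Ideal.Quotient.mk J))) := by
      rw [← Set.range_comp]
      rfl
    rw [hj, h1, hW.fromSpec_image_zeroLocus]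
    have h2 := I.coe_support_inter ⟨W, hW⟩
    rw [hI, Scheme.IdealSheafData.coe_support_vanishingIdeal] at h2
    change (Z : Set V) ∩ W = V.zeroLocus (U := W) (J : Set Γ(V, W)) ∩ W at h2
    rw [← h2, Set.inter_eq_left.mpr hZW]
  have hclosed : IsClosed (Set.range j) := by
    rw [hrange]
    exact Z.isClosed
  haveI : IsClosedImmersion j := IsClosedImmersion.of_isPreimmersion j hclosed
  haveI := hreg
  have hY : Scheme.IsRegular (Spec (CommRingCat.of (Γ(V, W) ⧸ J))) := Scheme.isRegular_Spec _
  have h := isRegular_subscheme_vanishingIdeal_range j hY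
  have hZ : (⟨Set.range j, j.isClosedEmbedding.isClosed_range⟩ : Closeds V) = Z :=
    Closeds.ext hrange
  rwa [hZ] at h

end Summit.ResolutionOfSingularities.ResolutionOfSingularities.Theorems.WildQuotientResolution.TowerCentre

end
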